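import Summits.QuantumFields.BalabanUV.Beta.GAN24.ResolventLegCharges

/-!
# `BalabanUV.Beta.GAN24.StepResolventLegCharges` — row G-an2-4 ∕ (CONV-C), W-slot, SKELETON-W3 §7.2 zero-mode calculus, «W3-S3C*» PART 4 (addendum):
# THE FOUR SITE-FREE COARSE-LEG CHARGES OF THE W-SLOT's ONE-STEP KERNEL `K♮_j = unitK s_f s_m (KInvStep Lc j)` AT BLOCKING `Lc`, AND ITS SANDWICH READ-OUT

NOT IN PRINT; OUR PROOF ATTEMPT (idle-seat kernel lemma, unit `b2b-balaban-gan24-formalise-leaf-06`, gen 8; journal INTENT «W3-S3C*» PART 4).  HONEST FRAMING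
(cell contract, verbatim): «discharging `BetaPertH` makes Bałaban's UV stability UNCONDITIONAL — a real constructive-QFT result; it is NOT the continuum limit and
NOT the Clay problem.»  HONEST DEPENDENCY (verbatim): «continuum YM on T⁴ ⇐ BetaPertH ∧ nine spine estimates (0/9 proved); BetaPertH ⇐ (D1) ∧ (D4) ∧ CAP+tail;
G-an2-4 gates asym, D1 and NE2/3/4.»

WHAT ([folklore]; generic `d`, every `Lc ≥ 1`, every level `j`, all real units `s_f s_m`; 0 `def`, 0 cite, 0 sorry).  an4's decimated composite resolvent
`OneStepKernelFamily.KInvStep Lc j` (the one-step kernel on the level-`j` lattice, blocking `Lc`) has SITE-FREE coarse-leg charges: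
* §1 field–multiplier COLUMN `Σ'_{z′} KInvStep Lc j w (Lc•z′) (inl a) (inr β) = δ_{aβ}·(Lc^{j+1})^{−(d+2)}` for EVERY fine `w` (`hasSum_KInvStep_inl_inr`: (Q-lin) =
  an4's `HessianTelescopingKKT.constReproSum_stepCol` in the `y`-form + block covariance `shiftK_KInvStep`); multiplier–field ROW = minus the same
  (`hasSum_KInvStep_inr_inl`: `ResolventComposition.KInvStep_inr_inl`∕`KInvStep_inl_inr`, the `mf = −fmᵀ` convention); the two multiplier–multiplier legs ZERO
  ((S2c), leaf-14's `MultiplierZeroMass.hasSum_KInvStep_mm_left/right` BY NAME); packaged on the fibre as `hasSum_KInvStep_row` ∕ `hasSum_KInvStep_col`;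
* §2 the `unitK s_f s_m` dressing of site-free charge families (`hasSum_unitK_row` ∕ `hasSum_unitK_col`: entry `(a, b) ↦ legScale a · K · legScale b`);
* §3 **`hasSum_sandwich_readout_KInvStep`** ∕ **`hasSum_sandwich_readout_unitKStep`**: for ANY bi-localised `V`, the `mm`-read at blocking `Lc` of `K ∘ V ∘ K` for
  `K = KInvStep Lc j` resp. `K♮_j = unitK s_f s_m (KInvStep Lc j)` has the double-leg `HasSum` `−σ_j²·Σ'_{(y,w)} V y w (inl α) (inl β)` resp.
  `−(s_f·s_m·σ_j)²·Σ'_{(y,w)} V …`, `σ_j := (Lc^{j+1})^{−(d+2)}` — ONLY the field–field double-leg sum of `V` survives (PART 2a's generic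
  `ResolventLegCharges.hasSum_sandwich_readout` with the charges of §1–§2).
READING (docstring level, asserted nowhere): `K♮_j` at `(s_f, s_m) = (sfStep Lc j, smStep d Lc j)` is the kernel of the normalised `T2Of` recursion ∕ of the source of record
`b_j` (`W3SourceRows`); this addendum is the `K`-side input of the level-`j` zero-mode calculus (F2a∕F2b), the `S`-side being (S3c) (`SpureChargeZero`).  Asserts NO shape
of Bałaban's tables, pins no colour constant, is NOT a W3 row, discharges NOTHING of «T2Shape»∕«T2SupRate»∕(hW, hWall).  NOT «W-slot closed», NEVER «G-an2-4
closed»; NOT BetaPertH, NOT continuum, NOT Clay.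
-/

noncomputable section

open Finset
open scoped BigOperators
open Literature.MathematicalPhysics.QuantumFieldTheory
open Literature.MathematicalPhysics.QuantumFieldTheory.Balaban1983to89
open Literature.MathematicalPhysics.QuantumFieldTheory.Balaban1983to89.Beta
open B12Sec2to5 (l1)
open ExpKernelCalculus (Site MKer BiLoc Decays comp shiftK)
open KernelRepresentationSummable (constReproSum_iff_decimated)
open OneStepResolventKernel (Fib)
open OneStepKernelFamily (KInvStep decays_KInvStep shiftK_KInvStep)
open HessianTelescopingKKT (stepCol constReproSum_stepCol)
open ResolventComposition (KInvStep_inl_inr KInvStep_inr_inl)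
open Summit.QuantumFields.BalabanUV.Beta.HessKerDressedUnits (unitK unitK_apply legScale legScale_inl legScale_inr decays_unitK)
open Summit.QuantumFields.BalabanUV.Beta.GAN24.MultiplierZeroMass (hasSum_KInvStep_mm_left hasSum_KInvStep_mm_right)
open Summit.QuantumFields.BalabanUV.Beta.GAN24.ResolventLegCharges (hasSum_sandwich_readout)

namespace Summit.QuantumFields.BalabanUV.Beta.GAN24.StepResolventLegCharges

variable {d : ℕ} {Lc : ℕ} [NeZero Lc]

/-! ## §1 The four coarse-leg charges of `KInvStep Lc j` at blocking `Lc` -/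

/-- [folklore] **FIELD–MULTIPLIER COLUMN CHARGE OF THE STEP KERNEL**: for every fine `w` of the level-`j` lattice,
`Σ'_{z′} KInvStep Lc j w (Lc•z′) (inl a) (inr β) = δ_{aβ} · (Lc^{j+1})^{−(d+2)}` ((Q-lin): `constReproSum_stepCol`). -/
theorem hasSum_KInvStep_inl_inr (j : ℕ) (a β : Fin (d + 1)) (w : Site (d + 1)) :
    HasSum (fun z' : Site (d + 1) => KInvStep (d := d) Lc j w (((Lc : ℕ) : ℤ) • z') (Sum.inl a) (Sum.inr β))
      (if a = β then ((((Lc ^ (j + 1) : ℕ) : ℝ)) ^ (d + 1 + 1))⁻¹ else 0) := by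
  have h := (constReproSum_iff_decimated (NeZero.ne Lc) (stepCol (d := d) Lc j a β) _).1 (constReproSum_stepCol (d := d) (Lc := Lc) j a β) (-w)
  have h2 := ((Equiv.neg (Site (d + 1))).hasSum_iff (f := fun y : Site (d + 1) => stepCol (d := d) Lc j a β (-w - (Lc : ℤ) • y))).2 h
  refine h2.congr_fun fun z' => ?_
  have e := congrFun (congrFun (congrFun (congrFun (shiftK_KInvStep (d := d) (Lc := Lc) j z') w) ((Lc : ℤ) • z')) (Sum.inl a)) (Sum.inr β)
  simp only [shiftK, add_neg_cancel] at e
  show KInvStep (d := d) Lc j w (((Lc : ℕ) : ℤ) • z') (Sum.inl a) (Sum.inr β) = KInvStep (d := d) Lc j (-(-w - (Lc : ℤ) • (-z'))) 0 (Sum.inl a) (Sum.inr β)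
  rw [← e]
  congr 1
  simp only [smul_neg, sub_neg_eq_add, neg_add_rev, neg_neg]
  abel

/-- [folklore] **MULTIPLIER–FIELD ROW CHARGE OF THE STEP KERNEL** (`mf = −fmᵀ`): for every fine `y`,
`Σ'_{x′} KInvStep Lc j (Lc•x′) y (inr α) (inl a) = −δ_{aα} · (Lc^{j+1})^{−(d+2)}`. -/
theorem hasSum_KInvStep_inr_inl (j : ℕ) (α a : Fin (d + 1)) (y : Site (d + 1)) :
    HasSum (fun x' : Site (d + 1) => KInvStep (d := d) Lc j (((Lc : ℕ) : ℤ) • x') y (Sum.inr α) (Sum.inl a))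
      (-(if a = α then ((((Lc ^ (j + 1) : ℕ) : ℝ)) ^ (d + 1 + 1))⁻¹ else 0)) := by
  refine (hasSum_KInvStep_inl_inr (d := d) (Lc := Lc) j a α y).neg.congr_fun fun x' => ?_
  rw [KInvStep_inr_inl, KInvStep_inl_inr]

/-- [folklore] **THE ROW CHARGES OF `KInvStep Lc j` AGAINST `inr α`, ON THE FIBRE**: `−δ_{aα}·σ_j` on field legs, `0` on multiplier legs ((S2c) BY NAME). -/
theorem hasSum_KInvStep_row (j : ℕ) (α : Fin (d + 1)) (f : Fib d) (y : Site (d + 1)) :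
    HasSum (fun x' : Site (d + 1) => KInvStep (d := d) Lc j (((Lc : ℕ) : ℤ) • x') y (Sum.inr α) f)
      (Sum.elim (fun a => -(if a = α then ((((Lc ^ (j + 1) : ℕ) : ℝ)) ^ (d + 1 + 1))⁻¹ else 0)) (fun _ => (0 : ℝ)) f) := by
  rcases f with a | m
  · exact hasSum_KInvStep_inr_inl j α a y
  · exact hasSum_KInvStep_mm_left j α m y

/-- [folklore] **THE COLUMN CHARGES OF `KInvStep Lc j` AGAINST `inr β`, ON THE FIBRE**: `+δ_{bβ}·σ_j` on field legs, `0` on multiplier legs. -/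
theorem hasSum_KInvStep_col (j : ℕ) (β : Fin (d + 1)) (g : Fib d) (w : Site (d + 1)) :
    HasSum (fun z' : Site (d + 1) => KInvStep (d := d) Lc j w (((Lc : ℕ) : ℤ) • z') g (Sum.inr β))
      (Sum.elim (fun b => if b = β then ((((Lc ^ (j + 1) : ℕ) : ℝ)) ^ (d + 1 + 1))⁻¹ else 0) (fun _ => (0 : ℝ)) g) := by
  rcases g with b | m
  · exact hasSum_KInvStep_inl_inr j b β w
  · exact hasSum_KInvStep_mm_right j m β w

/-! ## §2 Dressing site-free charges by the units `unitK s_f s_m` -/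

/-- [folklore] Row charges of `unitK s_f s_m K` against a multiplier leg: `s_m · ρ f · legScale s_f s_m f`. -/
theorem hasSum_unitK_row {K : MKer (d + 1) (Fib d)} {N : ℕ} (sf sm : ℝ) {α : Fin (d + 1)} {f : Fib d} {y : Site (d + 1)} {ρ : ℝ}
    (h : HasSum (fun x' : Site (d + 1) => K ((N : ℤ) • x') y (Sum.inr α) f) ρ) :
    HasSum (fun x' : Site (d + 1) => unitK sf sm K ((N : ℤ) • x') y (Sum.inr α) f) (sm * ρ * legScale sf sm f) := by
  refine ((h.mul_left sm).mul_right (legScale sf sm f)).congr_fun fun x' => ?_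
  rw [unitK_apply, legScale_inr]

/-- [folklore] Column charges of `unitK s_f s_m K` against a multiplier leg: `legScale s_f s_m g · ρ g · s_m`. -/
theorem hasSum_unitK_col {K : MKer (d + 1) (Fib d)} {N : ℕ} (sf sm : ℝ) {β : Fin (d + 1)} {g : Fib d} {w : Site (d + 1)} {ρ : ℝ}
    (h : HasSum (fun z' : Site (d + 1) => K w ((N : ℤ) • z') g (Sum.inr β)) ρ) :
    HasSum (fun z' : Site (d + 1) => unitK sf sm K w ((N : ℤ) • z') g (Sum.inr β)) (legScale sf sm g * ρ * sm) := by
  refine ((h.mul_left (legScale sf sm g)).mul_right sm).congr_fun fun z' => ?_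
  rw [unitK_apply, legScale_inr]

/-! ## §3 The sandwich read-out through the step kernel -/

/-- [folklore] The fibre bookkeeping of the read-out value: with row charges `−δ_{aα}·s` ∕ `0` and column charges `+δ_{bβ}·t` ∕ `0`,
`Σ_{f,g} ρL f · V f g · ρR g = −(s·t) · V (inl α) (inl β)`. -/
theorem sum_elim_charges (V : Fib d → Fib d → ℝ) (α β : Fin (d + 1)) (s t : ℝ) :
    ∑ f, ∑ g, Sum.elim (fun a => -(if a = α then s else 0)) (fun _ => (0 : ℝ)) f * V f g *
        Sum.elim (fun b => if b = β then t else 0) (fun _ => (0 : ℝ)) g = -(s * t) * V (Sum.inl α) (Sum.inl β) := by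
  rw [Fintype.sum_sum_type]
  have hr : ∑ m : Fin (d + 1), ∑ g, Sum.elim (fun a => -(if a = α then s else 0)) (fun _ => (0 : ℝ)) (Sum.inr m : Fib d) * V (Sum.inr m) g *
      Sum.elim (fun b => if b = β then t else 0) (fun _ => (0 : ℝ)) g = 0 :=
    Finset.sum_eq_zero fun m _ => Finset.sum_eq_zero fun g _ => by simp only [Sum.elim_inr, zero_mul]
  rw [hr, add_zero]
  have hl : ∀ a : Fin (d + 1), ∑ g, Sum.elim (fun a => -(if a = α then s else 0)) (fun _ => (0 : ℝ)) (Sum.inl a : Fib d) * V (Sum.inl a) g *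
      Sum.elim (fun b => if b = β then t else 0) (fun _ => (0 : ℝ)) g = -(if a = α then s else 0) * V (Sum.inl a) (Sum.inl β) * t := by
    intro a
    rw [Fintype.sum_sum_type]
    have h2 : ∑ m : Fin (d + 1), Sum.elim (fun a => -(if a = α then s else 0)) (fun _ => (0 : ℝ)) (Sum.inl a : Fib d) * V (Sum.inl a) (Sum.inr m) *
        Sum.elim (fun b => if b = β then t else 0) (fun _ => (0 : ℝ)) (Sum.inr m : Fib d) = 0 :=
      Finset.sum_eq_zero fun m _ => by simp only [Sum.elim_inr, mul_zero]
    rw [h2, add_zero, Finset.sum_eq_single β]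
    · show -(if a = α then s else 0) * V (Sum.inl a) (Sum.inl β) * (if β = β then t else 0) = _
      rw [if_pos rfl]
    · intro b _ hb
      simp only [Sum.elim_inl, if_neg hb, mul_zero]
    · intro hβ
      exact absurd (Finset.mem_univ β) hβ
  simp_rw [hl]
  rw [Finset.sum_eq_single α]
  · rw [if_pos rfl]
    ring
  · intro a _ ha
    rw [if_neg ha, neg_zero, zero_mul, zero_mul]
  · intro hα
    exact absurd (Finset.mem_univ α) hα

/-- [folklore] **THE SANDWICH READ-OUT THROUGH `KInvStep Lc j`**: for ANY bi-localised `V` on the level-`j` lattice,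
`Σ'_{(x′,z′)} (KInvStep ∘ V ∘ KInvStep)(Lc•x′, Lc•z′)_{(inr α, inr β)} = −σ_j² · Σ'_{(y,w)} V y w (inl α) (inl β)`, `σ_j = (Lc^{j+1})^{−(d+2)}`. -/
theorem hasSum_sandwich_readout_KInvStep (j : ℕ) {V : MKer (d + 1) (Fib d)} {Cv δv : ℝ} {p q : Site (d + 1)} (hV : BiLoc V p q Cv δv)
    (hδv : 0 < δv) (α β : Fin (d + 1)) :
    HasSum (fun xz : Site (d + 1) × Site (d + 1) =>
        comp (comp (KInvStep (d := d) Lc j) V) (KInvStep (d := d) Lc j) (((Lc : ℕ) : ℤ) • xz.1) (((Lc : ℕ) : ℤ) • xz.2) (Sum.inr α) (Sum.inr β))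
      (-(((((Lc ^ (j + 1) : ℕ) : ℝ)) ^ (d + 1 + 1))⁻¹ * ((((Lc ^ (j + 1) : ℕ) : ℝ)) ^ (d + 1 + 1))⁻¹) *
        ∑' yw : Site (d + 1) × Site (d + 1), V yw.1 yw.2 (Sum.inl α) (Sum.inl β)) := by
  obtain ⟨δ, C, hδ, hC, hK⟩ := decays_KInvStep (d := d) (Lc := Lc) j
  have h := hasSum_sandwich_readout (N := Lc) hK hδ hV hδv α β (fun f y => hasSum_KInvStep_row j α f y) (fun g w => hasSum_KInvStep_col j β g w)
  simp_rw [sum_elim_charges] at h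
  rw [tsum_mul_left] at h
  exact h

/-- [folklore] **THE SANDWICH READ-OUT THROUGH THE NORMALISED STEP KERNEL `K♮_j = unitK s_f s_m (KInvStep Lc j)`**: for ANY bi-localised `V`,
`Σ'_{(x′,z′)} (K♮_j ∘ V ∘ K♮_j)(Lc•x′, Lc•z′)_{(inr α, inr β)} = −(s_f·s_m·σ_j)² · Σ'_{(y,w)} V y w (inl α) (inl β)` — every level `j`, all units. -/
theorem hasSum_sandwich_readout_unitKStep (sf sm : ℝ) (j : ℕ) {V : MKer (d + 1) (Fib d)} {Cv δv : ℝ} {p q : Site (d + 1)}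
    (hV : BiLoc V p q Cv δv) (hδv : 0 < δv) (α β : Fin (d + 1)) :
    HasSum (fun xz : Site (d + 1) × Site (d + 1) =>
        comp (comp (unitK sf sm (KInvStep (d := d) Lc j)) V) (unitK sf sm (KInvStep (d := d) Lc j))
          (((Lc : ℕ) : ℤ) • xz.1) (((Lc : ℕ) : ℤ) • xz.2) (Sum.inr α) (Sum.inr β))
      (-((sf * sm * ((((Lc ^ (j + 1) : ℕ) : ℝ)) ^ (d + 1 + 1))⁻¹) * (sf * sm * ((((Lc ^ (j + 1) : ℕ) : ℝ)) ^ (d + 1 + 1))⁻¹)) *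
        ∑' yw : Site (d + 1) × Site (d + 1), V yw.1 yw.2 (Sum.inl α) (Sum.inl β)) := by
  obtain ⟨δ, C, hδ, hC, hK⟩ := decays_KInvStep (d := d) (Lc := Lc) j
  set σ : ℝ := ((((Lc ^ (j + 1) : ℕ) : ℝ)) ^ (d + 1 + 1))⁻¹ with hσ
  have hKu : Decays (unitK sf sm (KInvStep (d := d) Lc j)) (max |sf| |sm| * C * max |sf| |sm|) δ := decays_unitK hK
  have hrow : ∀ (f : Fib d) (y : Site (d + 1)), HasSum (fun x' : Site (d + 1) =>
      unitK sf sm (KInvStep (d := d) Lc j) (((Lc : ℕ) : ℤ) • x') y (Sum.inr α) f)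
      (Sum.elim (fun a => -(if a = α then sm * σ * sf else 0)) (fun _ => (0 : ℝ)) f) := by
    intro f y
    have h := hasSum_unitK_row sf sm (hasSum_KInvStep_row (d := d) (Lc := Lc) j α f y)
    rcases f with a | m
    · simp only [Sum.elim_inl, legScale_inl] at h ⊢
      convert h using 1
      split_ifs <;> ring
    · simp only [Sum.elim_inr, legScale_inr, mul_zero, zero_mul] at h ⊢
      exact h
  have hcol : ∀ (g : Fib d) (w : Site (d + 1)), HasSum (fun z' : Site (d + 1) =>
      unitK sf sm (KInvStep (d := d) Lc j) w (((Lc : ℕ) : ℤ) • z') g (Sum.inr β))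
      (Sum.elim (fun b => if b = β then sf * σ * sm else 0) (fun _ => (0 : ℝ)) g) := by
    intro g w
    have h := hasSum_unitK_col sf sm (hasSum_KInvStep_col (d := d) (Lc := Lc) j β g w)
    rcases g with b | m
    · simp only [Sum.elim_inl, legScale_inl] at h ⊢
      convert h using 1
      split_ifs <;> ring
    · simp only [Sum.elim_inr, legScale_inr, mul_zero, zero_mul] at h ⊢
      exact h
  have h := hasSum_sandwich_readout (N := Lc) hKu hδ hV hδv α β hrow hcol
  simp_rw [sum_elim_charges] at h
  rw [tsum_mul_left] at h
  convert h using 2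
  ring

end Summit.QuantumFields.BalabanUV.Beta.GAN24.StepResolventLegCharges

end
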